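import Literature.AlgebraicGeometry.Resolution.DerivativeIdealSheaf
import Literature.AlgebraicGeometry.Resolution.SmoothCoordinates
import Mathlib.AlgebraicGeometry.Morphisms.Smooth
import Mathlib.AlgebraicGeometry.Noetherian
import HarnessLib

/-!
# BGMW Lemma 3.5.2 with equality and the closedness of `supp(𝓘, μ)`, on smooth schemes over perfect fields

Topic: `Literature/AlgebraicGeometry/Resolution`. Bierstone–Grigoriev–Milman–Włodarczyk, *Effective
Hironaka resolution and its complexity (with appendix on applications in positive
characteristic)*, arXiv:1206.3090, §3.1 and §3.5 (p. 6–7, arXiv numbering):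

* **Lemma 3.5.2** (Giraud, Villamayor): "For any `i ≤ μ - 1`, `supp(𝓘, μ) = supp(𝒟ⁱ(𝓘), μ - i)`.
  In particular, `supp(𝓘, μ) = supp(𝒟^{μ-1}(𝓘), 1) = V(𝒟^{μ-1}(𝓘))` is a closed set."
* **Remark (3) after Def. 3.1.2**: "For any marked ideal `(𝓘, μ)` on `X`, `supp(𝓘, μ)` is a closed
  subset of `X` (Lemma 3.5.2)."
* **Def. 3.6.1** (Villamayor): "`(𝓘, μ)` is of maximal order if `max {ord_x(𝓘) | x ∈ X} ≤ μ` or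
  equivalently `𝒟^μ(𝓘) = 𝒪_X`."

These are characteristic-sensitive (BGMW §2, p. 5: characteristic zero "is only needed for the
local existence of a hypersurface of maximal contact"; §8, Thm. 8.0.4: in characteristic `p` one
"replace[s] the hypothesis of characteristic zero with the one that the multiplicity `μ` in the
relevant marked ideals is less than characteristic `p` in Lemmas [3.5.2, …]") and they are the
first items on the list of inputs of the resolution algorithm (Thm. 4.0.6 / Thm. 8.0.5) whose
existence clause for `(𝔸ⁿ, (S), ∅, 1)` is the standing named fact
`BierstoneGrigorievMilmanWlodarczyk2011_marked` (`EffectiveResolutionMarked.lean`). This file PROVES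
them at the SHEAF level, over Mathlib and the tree:

* the inclusion `⊆` of Lemma 3.5.2 in every characteristic is `MarkedIdeal.support_subset_support_deriv`
  (`DerivativeIdealSheaf.lean`); the reverse inclusion at a point with coordinates and dual
  derivations is `CoordSystem.le_pow_iff_derivIdealIter_le_pow` (`DerivativeIdealsCoordinates.lean`);
  coordinates with dual derivations exist at every point of a scheme smooth over a perfect field
  (`nonempty_coordSystem_of_perfectField`, `SmoothCoordinates.lean`). Here these are assembled.

## Content

* `HasLocalCoordinates φ` — every local ring `𝒪_{X,x}` of the scheme `X` with `k`-structure `φ`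
  carries a coordinate system with dual `k`-derivations (BGMW §3.5: "`Der_K(𝒪_X)` is locally
  generated by the derivations `∂/∂uᵢ`");
* `MarkedIdeal.support_deriv_eq` — **Lemma 3.5.2 with equality**: `supp(𝒟ⁱ(𝓘), μ - i) = supp(𝓘, μ)`
  for `i < μ`, on a scheme with finitely presented differentials and local coordinates, provided
  `1, …, μ - 1` are units in the local rings (characteristic zero, or `μ ≤ p`);
* `MarkedIdeal.support_eq_support_derivIdealSheafIter`, `MarkedIdeal.isClosed_support` — **"in
  particular `supp(𝓘, μ) = V(𝒟^{μ-1}(𝓘))` is a closed set"** (Lemma 3.5.2, Remark (3));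
* `derivIdealSheafIter_eq_top_iff` — **Def. 3.6.1, "equivalently"**: `𝒟^μ(𝓘) = 𝒪_X` iff
  `ord_x(𝓘) ≤ μ` for all `x` (units `1, …, μ`);
* for a scheme `X` SMOOTH over a PERFECT field `k` (Mathlib's `Smooth (X ↘ Spec k)`):
  `smooth_sectionsHom_overHom`, `finiteType_sectionsHom_overHom` (affine pieces are smooth /
  finite type `k`-algebras), `essFiniteType_stalk_overHom`, `formallySmooth_stalk_overHom`,
  `isLocallyNoetherian_of_locallyOfFiniteType_over` and **`hasLocalCoordinates_overHom`**
  (coordinates exist at every point); `isUnit_natCast_stalk_overHom` (`0 < j < p ⇒ j` a unit in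
  `𝒪_{X,x}`); and the packaged forms in characteristic `p` (or `0`) —
  `MarkedIdeal.support_deriv_eq_of_smooth`, `MarkedIdeal.isClosed_support_of_smooth` (`μ ≤ p`),
  `derivIdealSheafIter_eq_top_iff_of_smooth` (`μ < p`).

Faithfulness: BGMW work on smooth varieties over an algebraically closed field; the statements
are proved here for arbitrary schemes smooth over a perfect field (in particular at non-closed
points), which is the generality in which the tree's marked ideals (`MarkedIdeals.lean`) live.

## Sources

* [BGMW 2011] §3.1 Def. 3.1.2 and Remark (3); §3.5 Def. 3.5.1, Lemma 3.5.2; §3.6 Def. 3.6.1; §2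
  p. 5; §8 Thm. 8.0.4 (arXiv:1206.3090 numbering). [BierstoneGrigorievMilmanWlodarczyk2011]
* H. Matsumura, *Commutative Ring Theory* (1986), Thm. 30.6 (ii) — through `SmoothCoordinates.lean`.
  [Matsumura1987]
-/

namespace Literature.AlgebraicGeometry.Resolution

open CategoryTheory _root_.AlgebraicGeometry TopologicalSpace IsLocalRing Opposite

universe u v

/-! ## Local coordinates with dual derivations -/

section Local

variable {k : Type v} [CommRing k] {X : Scheme.{u}} (φ : k →+* Γ(X, ⊤))

/-- **Local coordinates with dual derivations at every point** of the scheme `X` with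
`k`-structure `φ`: for every `x ∈ X` the local ring `𝒪_{X,x}` admits a minimal system of
generators `u_1, …, u_d` of `𝔪_x` (`d` its minimal number of generators) together with
`k`-derivations `δ_1, …, δ_d` of `𝒪_{X,x}` with `δ_i(u_j) = δ_{ij}` (`CoordSystem`; BGMW §3.5:
"`Der_K(𝒪_X)` is locally generated by the derivations `∂/∂uᵢ`"). Holds for `X` smooth over a
perfect field (`hasLocalCoordinates_overHom`). [cite: BierstoneGrigorievMilmanWlodarczyk2011, §3.5] -/
def HasLocalCoordinates : Prop :=
  ∀ x : X, Nonempty (letI := stalkAlgebra φ x;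
    CoordSystem k (maximalIdeal (X.presheaf.stalk x))
      (Fin (maximalIdeal (X.presheaf.stalk x)).spanFinrank))

variable {φ}

/-! ## Lemma 3.5.2 with equality; closedness of the support -/

namespace MarkedIdeal

/-- **BGMW Lemma 3.5.2** (Giraud, Villamayor): for `i ≤ μ - 1`,
`supp(𝒟ⁱ(𝓘), μ - i) = supp(𝓘, μ)` — on a scheme with finitely presented differentials and local
coordinates with dual derivations at every point, provided the integers `1, …, μ - 1` are units in
all local rings (characteristic zero; in characteristic `p`: `μ ≤ p`, BGMW Thm. 8.0.4). The
inclusion `⊇` holds unconditionally (`support_subset_support_deriv`); `⊆` is the Euler-congruence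
argument `Σ uᵢ ∂ᵢ f ≡ s·f (mod 𝔪ˢ⁺¹)` at each point.
[cite: BierstoneGrigorievMilmanWlodarczyk2011, Lemma 3.5.2] -/
theorem support_deriv_eq (hX : HasFinitePresentationDifferentials φ) (hc : HasLocalCoordinates φ)
    (M : MarkedIdeal X)
    (hunit : ∀ (x : X) (j : ℕ), 0 < j → j < M.mult → IsUnit (j : X.presheaf.stalk x))
    {i : ℕ} (hi : i < M.mult) : (M.deriv φ i).support = M.support := by
  refine Set.Subset.antisymm ?_ (M.support_subset_support_deriv hX i)
  intro x hx
  rw [MarkedIdeal.mem_support_iff] at hx ⊢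
  rw [deriv_ideal, deriv_mult, stalkIdeal_derivIdealSheafIter hX] at hx
  letI := stalkAlgebra φ x
  obtain ⟨c⟩ := hc x
  exact (c.le_pow_iff_derivIdealIter_le_pow (hunit x) (stalkIdeal M.ideal x) hi).mpr hx

/-- **"In particular `supp(𝓘, μ) = supp(𝒟^{μ-1}(𝓘), 1) = V(𝒟^{μ-1}(𝓘))`"** (BGMW Lemma 3.5.2), for
`μ ≥ 1`, under the hypotheses of `support_deriv_eq`.
[cite: BierstoneGrigorievMilmanWlodarczyk2011, Lemma 3.5.2] -/
theorem support_eq_support_derivIdealSheafIter (hX : HasFinitePresentationDifferentials φ)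
    (hc : HasLocalCoordinates φ) (M : MarkedIdeal X)
    (hunit : ∀ (x : X) (j : ℕ), 0 < j → j < M.mult → IsUnit (j : X.presheaf.stalk x))
    (hμ : 1 ≤ M.mult) :
    M.support = ((derivIdealSheafIter φ (M.mult - 1) M.ideal).support : Set X) := by
  rw [← M.support_deriv_eq hX hc hunit (i := M.mult - 1) (by omega)]
  exact (M.deriv φ (M.mult - 1)).support_of_mult_eq_one (by rw [deriv_mult]; omega)

/-- **BGMW §3.1, Remark (3): `supp(X, 𝓘, E, μ)` is a closed subset of `X`** (by Lemma 3.5.2), under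
the hypotheses of `support_deriv_eq` (for `μ = 0` the support is all of `X`).
[cite: BierstoneGrigorievMilmanWlodarczyk2011, §3.1 Remark (3)] -/
theorem isClosed_support (hX : HasFinitePresentationDifferentials φ) (hc : HasLocalCoordinates φ)
    (M : MarkedIdeal X)
    (hunit : ∀ (x : X) (j : ℕ), 0 < j → j < M.mult → IsUnit (j : X.presheaf.stalk x)) :
    IsClosed M.support := by
  rcases Nat.eq_zero_or_pos M.mult with h0 | hpos
  · rw [M.support_of_mult_eq_zero h0]
    exact isClosed_univ
  · rw [M.support_eq_support_derivIdealSheafIter hX hc hunit hpos]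
    exact (derivIdealSheafIter φ (M.mult - 1) M.ideal).support.isClosed

end MarkedIdeal

/-- **BGMW Def. 3.6.1, "equivalently"**: `𝒟^μ(𝓘) = 𝒪_X` iff `ord_x(𝓘) ≤ μ` for every `x ∈ X`
(i.e. `supp(𝓘, μ + 1) = ∅`), on a scheme with finitely presented differentials and local
coordinates, provided `1, …, μ` are units in the local rings (characteristic zero, or `μ < p`).
[cite: BierstoneGrigorievMilmanWlodarczyk2011, Def. 3.6.1] -/
theorem derivIdealSheafIter_eq_top_iff (hX : HasFinitePresentationDifferentials φ)
    (hc : HasLocalCoordinates φ) (I : X.IdealSheafData) {μ : ℕ}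
    (hunit : ∀ (x : X) (j : ℕ), 0 < j → j ≤ μ → IsUnit (j : X.presheaf.stalk x)) :
    derivIdealSheafIter φ μ I = ⊤ ↔ ∀ x : X, idealOrder I x ≤ μ := by
  -- `V(𝒟^μ 𝓘) = supp(𝓘, μ + 1)` (Lemma 3.5.2 with `i = μ` for the marked ideal `(𝓘, μ + 1)`)
  have key : ((derivIdealSheafIter φ μ I).support : Set X) =
      (⟨I, [], μ + 1⟩ : MarkedIdeal X).support := by
    have h := MarkedIdeal.support_deriv_eq (φ := φ) hX hc ⟨I, [], μ + 1⟩
      (fun x j hj hjμ => hunit x j hj (by simpa [Nat.lt_add_one_iff] using hjμ)) (i := μ)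
      (Nat.lt_add_one μ)
    rw [← h, ((⟨I, [], μ + 1⟩ : MarkedIdeal X).deriv φ μ).support_of_mult_eq_one (by simp)]
    rfl
  have hmem : ∀ x : X, x ∈ ((derivIdealSheafIter φ μ I).support : Set X) ↔ ¬idealOrder I x ≤ μ := by
    intro x
    rw [key]
    change ((μ + 1 : ℕ) : ℕ∞) ≤ idealOrder I x ↔ _
    rw [Nat.cast_succ, ← not_lt, ENat.lt_coe_add_one_iff]
  rw [← Scheme.IdealSheafData.support_eq_bot_iff, ← Closeds.coe_eq_empty,
    Set.eq_empty_iff_forall_notMem]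
  exact forall_congr' fun x => by rw [hmem, not_not]

end Local

/-! ## Schemes smooth over a perfect field have local coordinates everywhere -/

section Smooth

variable (k : Type u) [Field k] (X : Scheme.{u}) [X.Over (Spec (.of k))]

/-- A scheme locally of finite type over a field is locally Noetherian. [folklore] -/
theorem isLocallyNoetherian_of_locallyOfFiniteType_over
    [LocallyOfFiniteType (X ↘ Spec (.of k))] : IsLocallyNoetherian X :=
  haveI : IsLocallyNoetherian (Spec (.of k)) := inferInstance
  LocallyOfFiniteType.isLocallyNoetherian (X ↘ Spec (.of k))

/-- For `X` smooth over `Spec k`, every affine piece `Γ(X, U)` is a smooth `k`-algebra.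
[folklore] -/
theorem smooth_sectionsHom_overHom [Smooth (X ↘ Spec (.of k))] (U : X.affineOpens) :
    (sectionsHom (overHom k X) U).Smooth := by
  have h := HasRingHomProperty.appLE (P := @Smooth) (f := X ↘ Spec (.of k)) inferInstance
    ⟨⊤, isAffineOpen_top _⟩ U le_top
  have h' := (RingHom.Smooth.respectsIso.cancel_left_isIso (Scheme.ΓSpecIso (.of k)).inv
    ((X ↘ Spec (.of k)).appLE ⊤ U le_top)).mpr h
  exact h'

/-- For `X` locally of finite type over `Spec k`, every affine piece `Γ(X, U)` is a `k`-algebra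
of finite type. [folklore] -/
theorem finiteType_sectionsHom_overHom [LocallyOfFiniteType (X ↘ Spec (.of k))]
    (U : X.affineOpens) : (sectionsHom (overHom k X) U).FiniteType := by
  have h := HasRingHomProperty.appLE (P := @LocallyOfFiniteType) (f := X ↘ Spec (.of k))
    inferInstance ⟨⊤, isAffineOpen_top _⟩ U le_top
  have h' := (RingHom.finiteType_respectsIso.cancel_left_isIso (Scheme.ΓSpecIso (.of k)).inv
    ((X ↘ Spec (.of k)).appLE ⊤ U le_top)).mpr h
  exact h'

/-- The local rings of a scheme locally of finite type over `k` are essentially of finite type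
over `k` (localizations of finite type algebras). [folklore] -/
theorem essFiniteType_stalk_overHom [LocallyOfFiniteType (X ↘ Spec (.of k))] (x : X) :
    letI := stalkAlgebra (overHom k X) x
    Algebra.EssFiniteType k (X.presheaf.stalk x) := by
  obtain ⟨U, hU, hxU, -⟩ :=
    exists_isAffineOpen_mem_and_subset (X := X) (x := x) (U := ⊤) (Opens.mem_top x)
  letI := sectionsAlgebra (overHom k X) U
  letI := stalkAlgebra (overHom k X) x
  letI algx : Algebra Γ(X, U) (X.presheaf.stalk x) := (X.presheaf.germ U x hxU).hom.toAlgebra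
  haveI : IsScalarTower k Γ(X, U) (X.presheaf.stalk x) :=
    IsScalarTower.of_algebraMap_eq fun c =>
      (RingHom.congr_fun (germ_comp_sectionsHom (overHom k X) U x hxU) c).symm
  haveI : IsLocalization.AtPrime (X.presheaf.stalk x) (hU.primeIdealOf ⟨x, hxU⟩).asIdeal :=
    hU.isLocalization_stalk ⟨x, hxU⟩
  haveI : Algebra.FiniteType k Γ(X, U) := finiteType_sectionsHom_overHom k X ⟨U, hU⟩
  haveI : Algebra.EssFiniteType Γ(X, U) (X.presheaf.stalk x) :=
    Algebra.EssFiniteType.of_isLocalization _ (hU.primeIdealOf ⟨x, hxU⟩).asIdeal.primeCompl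
  exact Algebra.EssFiniteType.comp k Γ(X, U) (X.presheaf.stalk x)

/-- The local rings of a scheme smooth over `k` are formally smooth over `k` (a localization of a
smooth algebra). [folklore] -/
theorem formallySmooth_stalk_overHom [Smooth (X ↘ Spec (.of k))] (x : X) :
    letI := stalkAlgebra (overHom k X) x
    Algebra.FormallySmooth k (X.presheaf.stalk x) := by
  obtain ⟨U, hU, hxU, -⟩ :=
    exists_isAffineOpen_mem_and_subset (X := X) (x := x) (U := ⊤) (Opens.mem_top x)
  letI := sectionsAlgebra (overHom k X) U
  letI := stalkAlgebra (overHom k X) x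
  letI algx : Algebra Γ(X, U) (X.presheaf.stalk x) := (X.presheaf.germ U x hxU).hom.toAlgebra
  haveI : IsScalarTower k Γ(X, U) (X.presheaf.stalk x) :=
    IsScalarTower.of_algebraMap_eq fun c =>
      (RingHom.congr_fun (germ_comp_sectionsHom (overHom k X) U x hxU) c).symm
  haveI : IsLocalization.AtPrime (X.presheaf.stalk x) (hU.primeIdealOf ⟨x, hxU⟩).asIdeal :=
    hU.isLocalization_stalk ⟨x, hxU⟩
  haveI : Algebra.FormallySmooth k Γ(X, U) :=
    (smooth_sectionsHom_overHom k X ⟨U, hU⟩).formallySmooth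
  haveI : Algebra.FormallySmooth Γ(X, U) (X.presheaf.stalk x) :=
    Algebra.FormallySmooth.of_isLocalization (hU.primeIdealOf ⟨x, hxU⟩).asIdeal.primeCompl
  exact Algebra.FormallySmooth.comp k Γ(X, U) (X.presheaf.stalk x)

/-- **Coordinates with dual derivations exist at every point of a scheme smooth over a perfect
field** (BGMW §3.5; Matsumura Thm. 30.6 (ii), via `nonempty_coordSystem_of_perfectField`).
[cite: BierstoneGrigorievMilmanWlodarczyk2011, §3.5] -/
theorem hasLocalCoordinates_overHom [PerfectField k] [Smooth (X ↘ Spec (.of k))] :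
    HasLocalCoordinates (overHom k X) := by
  intro x
  letI := stalkAlgebra (overHom k X) x
  haveI := isLocallyNoetherian_of_locallyOfFiniteType_over k X
  haveI : Algebra.EssFiniteType k (X.presheaf.stalk x) := essFiniteType_stalk_overHom k X x
  haveI : Algebra.FormallySmooth k (X.presheaf.stalk x) := formallySmooth_stalk_overHom k X x
  exact nonempty_coordSystem_of_perfectField

/-- Over a field of characteristic `p`, an integer `0 < j < p` (any `0 < j` if `p = 0`) is a unit in
every local ring `𝒪_{X,x}` of a `k`-scheme — the form of BGMW's hypothesis "multiplicity `< p`"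
(Thm. 8.0.4). [cite: BierstoneGrigorievMilmanWlodarczyk2011, Thm. 8.0.4] -/
theorem isUnit_natCast_stalk_overHom (p : ℕ) [CharP k p] (x : X) {j : ℕ} (hj : 0 < j)
    (hjp : p = 0 ∨ j < p) : IsUnit (j : X.presheaf.stalk x) := by
  letI := stalkAlgebra (overHom k X) x
  exact isUnit_natCast_of_pos_of_lt (k := k) p hj hjp

/-- **BGMW Lemma 3.5.2 on a scheme smooth over a perfect field of characteristic `p`** (or `0`):
for a marked ideal `(X, 𝓘, E, μ)` with `μ ≤ p` and `i < μ`, `supp(𝒟ⁱ(𝓘), μ - i) = supp(𝓘, μ)`.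
[cite: BierstoneGrigorievMilmanWlodarczyk2011, Lemma 3.5.2 with Thm. 8.0.4] -/
theorem MarkedIdeal.support_deriv_eq_of_smooth (p : ℕ) [CharP k p] [PerfectField k]
    [Smooth (X ↘ Spec (.of k))] (M : MarkedIdeal X) (hμ : p = 0 ∨ M.mult ≤ p) {i : ℕ}
    (hi : i < M.mult) : (M.deriv (overHom k X) i).support = M.support :=
  M.support_deriv_eq (hasFinitePresentationDifferentials_overHom k X)
    (hasLocalCoordinates_overHom k X)
    (fun x j hj hjμ => isUnit_natCast_stalk_overHom k X p x hj (hμ.imp id fun h => by omega)) hi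

/-- **BGMW §3.1 Remark (3) on a scheme smooth over a perfect field of characteristic `p`** (or
`0`): the support `supp(X, 𝓘, E, μ)` of a marked ideal with `μ ≤ p` is closed (it is
`V(𝒟^{μ-1}(𝓘))`, Lemma 3.5.2). [cite: BierstoneGrigorievMilmanWlodarczyk2011, §3.1 Remark (3)] -/
theorem MarkedIdeal.isClosed_support_of_smooth (p : ℕ) [CharP k p] [PerfectField k]
    [Smooth (X ↘ Spec (.of k))] (M : MarkedIdeal X) (hμ : p = 0 ∨ M.mult ≤ p) :
    IsClosed M.support :=
  M.isClosed_support (hasFinitePresentationDifferentials_overHom k X)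
    (hasLocalCoordinates_overHom k X)
    (fun x j hj hjμ => isUnit_natCast_stalk_overHom k X p x hj (hμ.imp id fun h => by omega))

/-- **BGMW Def. 3.6.1 on a scheme smooth over a perfect field of characteristic `p`** (or `0`):
for `μ < p`, `𝒟^μ(𝓘) = 𝒪_X` iff `ord_x(𝓘) ≤ μ` at every point ("marked ideals of maximal order").
[cite: BierstoneGrigorievMilmanWlodarczyk2011, Def. 3.6.1 with Thm. 8.0.4] -/
theorem derivIdealSheafIter_eq_top_iff_of_smooth (p : ℕ) [CharP k p] [PerfectField k]
    [Smooth (X ↘ Spec (.of k))] (I : X.IdealSheafData) {μ : ℕ} (hμ : p = 0 ∨ μ < p) :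
    derivIdealSheafIter (overHom k X) μ I = ⊤ ↔ ∀ x : X, idealOrder I x ≤ μ :=
  derivIdealSheafIter_eq_top_iff (hasFinitePresentationDifferentials_overHom k X)
    (hasLocalCoordinates_overHom k X) I
    (fun x j hj hjμ => isUnit_natCast_stalk_overHom k X p x hj (hμ.imp id fun h => by omega))

end Smooth

end Literature.AlgebraicGeometry.Resolution
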